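import Summits.Ventures.PercRepro.C041BlockMapForest
import Summits.Ventures.PercRepro.C041BlockMapFourCores
import Summits.Ventures.PercRepro.C041BlockMapTriangleBridge
import Summits.Ventures.PercRepro.C041BlockMapAnchorExit

/-!
# ROW C-041 — THE FOUR-VERTEX CLASSIFICATION, TOOLS: the hosts `host4 b`, and the one-step transport lemmas used
by the case files (p6, gen 37)

THE HOSTS. `host4 b` (`b : Fin 6 → Bool`) is `K₄` on the vertices `0` (the anchor), `1`, `2` (the exits) and `3`
(the inner vertex), the edge `e` (in `k4`'s order: `0→1`, `1→2`, `2→0`, `0→3`, `1→3`, `2→3`) kept when `b e`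
and turned into a LOOP at its first end when `¬ b e` — so `host4 b` has the same block map as the simple host with
the edge set `{e | b e}` up to the factor `2` per loop (`blockMap_addLoop`), and every simple two-exit host on
four vertices is one `host4 b`.  THE CLASSIFICATION (the case files `C041BlockMapHost4A` …): every `host4 b` is a
cone host as soon as the triangle and the cores `k4`, `d1`, `d2` are.  THE TOOLS: one-step transports of
`ConeHost` along a loop, a pendant vertex without exits, an isolated vertex without exits (from
`C041BlockMapPendantExits` / `C041BlockMapForest`), the triangle with `Bool`-indexed exits, the edge host / the
pair with one exit at the far end (`uplus` of the empty family), the exits of `ex2` exchanged (the mirror image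
`K₄ − au′` of the core `d2`), and the re-indexings `Bool ≃ …` that the case files use.
-/

namespace PercRepro

namespace ZoneZ

namespace MultiExit

open ZoneData Pendant Finset TwoExit TreeClosure

/-! ## The hosts -/

/-- THE SIMPLE TWO-EXIT HOSTS ON FOUR VERTICES, WITH LOOPS FOR THE ABSENT EDGES: `K₄` (anchor `0`, exits `1`,
`2`, inner vertex `3`) with the edge `e` kept when `b e` and turned into a loop at its first end otherwise. -/
def host4 (b : Fin 6 → Bool) : ZoneData (Fin 4) (Fin 6) Empty Empty where
  fst := k4.fst
  snd := fun e => if b e then k4.snd e else k4.fst e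
  at₁ := Empty.elim
  at₂ := Empty.elim

/-! ## One-step transports of `ConeHost` -/

section Steps

variable {ι V₁ E₁ U₁ U₂ : Type} (Z₁ : ZoneData V₁ E₁ U₁ U₂) (u : ι → V₁) (a₁ : V₁)
variable [Fintype ι] [DecidableEq ι] [Fintype E₁] [DecidableEq E₁]

omit [DecidableEq ι] in
/-- A loop doubles the block map. -/
theorem coneHost_addLoop (h : ConeHost Z₁ u a₁) (x : V₁) : ConeHost (addLoop Z₁ x) u a₁ := by
  intro w hw
  rw [blockMap_addLoop]
  exact (h w hw).smul 2 (by norm_num)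

omit [DecidableEq ι] in
/-- A pendant vertex carrying no exit doubles the block map. -/
theorem coneHost_addPendant_noexit (h : ConeHost Z₁ u a₁) (x : V₁) :
    ConeHost (addPendant Z₁ x) (fun k => some (u k)) (some a₁) := by
  intro w hw
  rw [blockMap_addPendant]
  exact (h w hw).smul 2 (by norm_num)

/-- An isolated vertex carrying no exit. -/
theorem coneHost_addIsolated_noexit (h : ConeHost Z₁ u a₁) :
    ConeHost (addIsolated Z₁) (fun k => some (u k)) (some a₁) := by
  have hs := coneHost_addIsolated_split Z₁ a₁ (ι₂ := Empty) u (coneHost_uplus_anchor Z₁ u a₁ h)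
  have hr := coneHost_reindex (Equiv.sumEmpty ι Empty).symm hs
  have he : (Sum.elim (fun k => some (u k)) fun _ : Empty => (none : Option V₁)) ∘
      (Equiv.sumEmpty ι Empty).symm = fun k => some (u k) := by
    funext k
    rfl
  rwa [he] at hr

omit [Fintype ι] [DecidableEq ι] in
/-- `uplus` of the empty family: every exit at `v`. -/
theorem uplus_empty (v : V₁) : uplus (fun k : Empty => k.elim) v = fun _ : Option Empty => v := by
  funext o
  rcases o with _ | k
  · rfl
  · exact k.elim

omit [Fintype ι] [DecidableEq ι] in
/-- A host with one exit (the `uplus` of the empty family) is a cone host. -/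
theorem coneHost_uplus_empty (v : V₁) : ConeHost Z₁ (uplus (fun k : Empty => k.elim) v) a₁ := by
  rw [uplus_empty]
  exact coneHost_const' Z₁ v a₁

end Steps

/-! ## The triangle with `Bool`-indexed exits; the exits of `ex2` exchanged -/

/-- The triangle with the exits indexed by `Bool` (`false ↦ 1`, `true ↦ 2`). -/
theorem coneHost_tri_ex2 (h : ConeHost tri triExit 0) : ConeHost tri (ex2 1 2) 0 := by
  have := coneHost_reindex boolEquivSum h
  rwa [triExit_comp] at this

/-- The exits of the triangle indexed by `Option Unit`: `none ↦ 2`, `some () ↦ 1`. -/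
theorem uplus_one_two : uplus (fun _ : Unit => (1 : Fin 3)) 2 = triExit ∘ Equiv.optionEquivSumPUnit Unit := by
  funext o
  rcases o with _ | ⟨⟩ <;> rfl

/-- The triangle with the exits `1` (at `some ()`) and `2` (at `none`). -/
theorem coneHost_tri_uplus (h : ConeHost tri triExit 0) : ConeHost tri (uplus (fun _ : Unit => (1 : Fin 3)) 2) 0 := by
  rw [uplus_one_two]
  exact coneHost_reindex _ h

/-- The exits `false`, `true` exchanged. -/
def boolSwap : Bool ≃ Bool where
  toFun := not
  invFun := not
  left_inv := Bool.not_not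
  right_inv := Bool.not_not

/-- `ex2 x y` re-indexed by the swap is `ex2 y x`. -/
theorem ex2_comp_boolSwap {V : Type} (x y : V) : ex2 x y ∘ boolSwap = ex2 y x := by
  funext b
  cases b <;> rfl

/-- A cone host with the two exits exchanged. -/
theorem coneHost_ex2_swap {V E U₁ U₂ : Type} [Fintype E] [DecidableEq E] {Z : ZoneData V E U₁ U₂} {x y a : V}
    (h : ConeHost Z (ex2 x y) a) : ConeHost Z (ex2 y x) a := by
  have := coneHost_reindex boolSwap h
  rwa [ex2_comp_boolSwap] at this

/-! ## Weak embeddings: incidences up to orientation -/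

section Weak

variable {V₁ E₁ U₁ U₂ V₂ E₂ W₁ W₂ : Type} (Z₁ : ZoneData V₁ E₁ U₁ U₂) (Z₂ : ZoneData V₂ E₂ W₁ W₂)

/-- `Joins` as a Boolean. -/
def JoinsB {V E T₁ T₂ : Type} [DecidableEq V] (Z : ZoneData V E T₁ T₂) (e : E) (x y : V) : Bool :=
  decide (Z.fst e = x ∧ Z.snd e = y) || decide (Z.fst e = y ∧ Z.snd e = x)

/-- `Joins` is its Boolean. -/
theorem joins_iff_joinsB {V E T₁ T₂ : Type} [DecidableEq V] (Z : ZoneData V E T₁ T₂) (e : E) (x y : V) :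
    Z.Joins e x y ↔ JoinsB Z e x y = true := by
  unfold ZoneData.Joins JoinsB
  simp only [Bool.or_eq_true, decide_eq_true_eq]

variable [DecidableEq V₂] (fv : V₁ → V₂) (fe : E₁ → E₂)

/-- THE RE-ORIENTED HOST: `Z₁` with every edge oriented as its image in `Z₂`. -/
def reorient : ZoneData V₁ E₁ U₁ U₂ where
  fst := fun e => if Z₂.fst (fe e) = fv (Z₁.fst e) then Z₁.fst e else Z₁.snd e
  snd := fun e => if Z₂.fst (fe e) = fv (Z₁.fst e) then Z₁.snd e else Z₁.fst e
  at₁ := Z₁.at₁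
  at₂ := Z₁.at₂

/-- The re-oriented host has the incidences of `Z₁`. -/
theorem reorient_joins_iff (e : E₁) (x y : V₁) : (reorient Z₁ Z₂ fv fe).Joins e x y ↔ Z₁.Joins e x y := by
  unfold ZoneData.Joins reorient
  dsimp only
  split_ifs
  · exact Iff.rfl
  · exact ⟨fun h => h.elim (fun h => Or.inr ⟨h.2, h.1⟩) fun h => Or.inl ⟨h.2, h.1⟩,
      fun h => h.elim (fun h => Or.inr ⟨h.2, h.1⟩) fun h => Or.inl ⟨h.2, h.1⟩⟩

/-- A WEAK EMBEDDING — an injective map of vertices, a bijection of edges and bijections of marks preserving the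
incidences up to orientation — is a zone embedding of the re-oriented host. -/
noncomputable def ZoneEmb.ofWeak (hinj : Function.Injective fv) (hbij : Function.Bijective fe) (t₁ : U₁ ≃ W₁) (t₂ : U₂ ≃ W₂)
    (hJ : ∀ e x y, Z₂.Joins (fe e) (fv x) (fv y) ↔ Z₁.Joins e x y)
    (h₁ : ∀ t, Z₂.at₁ (t₁ t) = fv (Z₁.at₁ t)) (h₂ : ∀ t, Z₂.at₂ (t₂ t) = fv (Z₁.at₂ t)) :
    ZoneEmb (reorient Z₁ Z₂ fv fe) Z₂ where
  v := fv
  inj := hinj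
  e := Equiv.ofBijective fe hbij
  t₁ := t₁
  t₂ := t₂
  fst_map := by
    intro e
    have hj := (hJ e (Z₁.fst e) (Z₁.snd e)).2 (Or.inl ⟨rfl, rfl⟩)
    show Z₂.fst (fe e) = fv (if Z₂.fst (fe e) = fv (Z₁.fst e) then Z₁.fst e else Z₁.snd e)
    split_ifs with h
    · exact h
    · rcases hj with ⟨h1, _⟩ | ⟨h1, _⟩
      · exact absurd h1 h
      · exact h1
  snd_map := by
    intro e
    have hj := (hJ e (Z₁.fst e) (Z₁.snd e)).2 (Or.inl ⟨rfl, rfl⟩)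
    show Z₂.snd (fe e) = fv (if Z₂.fst (fe e) = fv (Z₁.fst e) then Z₁.snd e else Z₁.fst e)
    split_ifs with h
    · rcases hj with ⟨_, h2⟩ | ⟨h1, h2⟩
      · exact h2
      · rw [h2, hinj (h1.symm.trans h)]
    · rcases hj with ⟨h1, _⟩ | ⟨_, h2⟩
      · exact absurd h1 h
      · exact h2
  at₁_map := h₁
  at₂_map := h₂

variable {ι : Type} [Fintype ι] [Fintype E₁] [DecidableEq E₁] [Fintype E₂] [DecidableEq E₂]

/-- **A host is a cone host when its image under a weak embedding is.** -/
theorem coneHost_of_weak (hinj : Function.Injective fv) (hbij : Function.Bijective fe) (t₁ : U₁ ≃ W₁)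
    (t₂ : U₂ ≃ W₂) (hJ : ∀ e x y, Z₂.Joins (fe e) (fv x) (fv y) ↔ Z₁.Joins e x y)
    (h₁ : ∀ t, Z₂.at₁ (t₁ t) = fv (Z₁.at₁ t)) (h₂ : ∀ t, Z₂.at₂ (t₂ t) = fv (Z₁.at₂ t)) (u : ι → V₁) (a₁ : V₁)
    {u₂ : ι → V₂} {a₂ : V₂} (hu : ∀ k, u₂ k = fv (u k)) (ha : a₂ = fv a₁) (h : ConeHost Z₂ u₂ a₂) :
    ConeHost Z₁ u a₁ := by
  have hr : ConeHost (reorient Z₁ Z₂ fv fe) u a₁ :=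
    coneHost_of_emb (ZoneEmb.ofWeak Z₁ Z₂ fv fe hinj hbij t₁ t₂ hJ h₁ h₂) u a₁ hu ha h
  intro w hw
  have := blockMap_iso (reorient Z₁ Z₂ fv fe) Z₁ (Equiv.refl V₁) (Equiv.refl E₁)
    (fun e x y => (reorient_joins_iff Z₁ Z₂ fv fe e x y).symm) u a₁ w
  simp only [Equiv.coe_refl, Function.id_comp, id_eq] at this
  rw [this]
  exact hr w hw

/-- The weak-embedding transport for UNMARKED hosts, with the incidences as a decided Boolean identity. -/
theorem coneHost_of_weakB [DecidableEq V₁] {W₁ W₂ : Type} [IsEmpty W₁] [IsEmpty W₂] {Z₁ : ZoneData V₁ E₁ Empty Empty}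
    {Z₂ : ZoneData V₂ E₂ W₁ W₂} (hinj : Function.Injective fv) (hbij : Function.Bijective fe)
    (hJ : ∀ e x y, JoinsB Z₂ (fe e) (fv x) (fv y) = JoinsB Z₁ e x y) (u : ι → V₁) (a₁ : V₁)
    {u₂ : ι → V₂} {a₂ : V₂} (hu : ∀ k, u₂ k = fv (u k)) (ha : a₂ = fv a₁) (h : ConeHost Z₂ u₂ a₂) :
    ConeHost Z₁ u a₁ :=
  coneHost_of_weak Z₁ Z₂ fv fe hinj hbij (Equiv.equivOfIsEmpty Empty W₁) (Equiv.equivOfIsEmpty Empty W₂)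
    (fun e x y => by rw [joins_iff_joinsB, joins_iff_joinsB, hJ]) (fun t => t.elim) (fun t => t.elim) u a₁ hu ha h

end Weak

/-! ## Re-indexings used by the case files -/

/-- `Bool ≃ Empty ⊕ Bool`. -/
def boolEquivEmptySum : Bool ≃ Empty ⊕ Bool := (Equiv.emptySum Empty Bool).symm

/-- `Bool ≃ Bool ⊕ Empty`. -/
def boolEquivSumEmpty : Bool ≃ Bool ⊕ Empty := (Equiv.sumEmpty Bool Empty).symm

/-- `Bool ≃ Unit ⊕ Unit` with `false ↦ inr ()`, `true ↦ inl ()`. -/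
def boolEquivSumSwap : Bool ≃ Unit ⊕ Unit := boolEquivSum.trans (Equiv.sumComm Unit Unit)

/-- `Bool ≃ Empty ⊕ Option Unit` with `false ↦ inr none`, `true ↦ inr (some ())`. -/
def boolEquivEmptySumOption : Bool ≃ Empty ⊕ Option Unit where
  toFun b := if b then Sum.inr (some ()) else Sum.inr none
  invFun := Sum.elim (fun k => k.elim) fun o => o.isSome
  left_inv := by decide
  right_inv := by
    rintro (k | _ | ⟨⟩)
    · exact k.elim
    · rfl
    · rfl

/-- `Bool ≃ Empty ⊕ Option Unit` with `false ↦ inr (some ())`, `true ↦ inr none`. -/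
def boolEquivEmptySumOption' : Bool ≃ Empty ⊕ Option Unit where
  toFun b := if b then Sum.inr none else Sum.inr (some ())
  invFun := Sum.elim (fun k => k.elim) fun o => !o.isSome
  left_inv := by decide
  right_inv := by
    rintro (k | _ | ⟨⟩)
    · exact k.elim
    · rfl
    · rfl

end MultiExit

end ZoneZ

end PercRepro
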